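import Summits.Ventures.FusionMHD.Bench.SolovevPCFIterMercierEdgeFluxForm
import Summits.Ventures.FusionMHD.Models.SolovevPCFSafetyFactorProfile
import Literature.MathematicalPhysics.MHD.SolovevFluxSurfaceForceBalance
import HarnessLib

/-!
# F1 / MERCIER at the ITER-like PCF edge — KERNEL BRIDGE 1/4: the half-angle substitution `t = 2·arcsin(√2·w/2)` and
# the printed edge loop in the substituted variable
(venture LADDER-GRIDFUSION, rung F1.MERCIER-profile; cell `gridfusion`, seat `gridfusion-sos-6` (g3), 2026-08-27.)

PURPOSE OF THE FOUR `…MercierEdge{Subst,Integrals1,Integrals2,Kernel}` FILES. The certified edge statement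
`∀ g ≥ 3/5, 0 < mercierF g` (`…MercierEdgeGGJ`, p479387) and its `SurfaceData` form (`…MercierEdgeFluxForm`, p481977) were
stated on sos-6's OWN one-dimensional reduction of the flux-surface functionals (the «1-D reduction» was the MODELLED caveat
of those files).  Meanwhile gridfusion-model-5 typed the GGJ INPUT BRIDGE `Solovev.lcGGJData κ F_B R₀ q₀ a g r`
(`Literature/…/SolovevFluxSurfaceGGJData`, p481986): the thirteen Jardin (8.134) inputs as the TREE'S functionals
(`volumeDerivE` (5.29)/(6.22), `toroidalFluxDerivJ` (5.31), `toroidalCurrentJ` (5.34), `surfaceAverageE` (5.30)) of the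
Lee–Cerfon flux function on the printed loop `lcLoop`, each PROVED equal to an explicit `t`-integral over `[0, 2π]`; and
`Models/SolovevPCFSafetyFactorProfile` (p474120) proved `IterLike.psi = psiLC κ₀ F R_a q₀(F) (ε/R_a)`.  These four files
prove, in the kernel, that model-5's record OF THE EDGE SURFACE `r = a = ε/R_a` IS the certificate's record:
`lcGGJData κ₀ g R_a q₀(g) (ε/R_a) g (ε/R_a) = edgeData g (Vp/(2π))` (all thirteen fields; file 4/4), hence
`SurfaceData.MercierCriterion` for every `g = F ≥ 3/5` holds for the tree's own functionals of the typed equilibrium —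
the 1-D reduction is no longer a MODELLED caveat but a theorem.  NO new enclosure is needed: the substitution below turns
each of model-5's nine atomic `t`-integrals into an exact rational multiple of the already kernel-enclosed `K₁…K₈`, `KX`,
`KY` (files 2–3/4).

THIS FILE: §1 the substitution `θ(w) = 2·arcsin(√2·w/2)` — `cos θ = 1 − w²`, `θ′ = 2/√(2−w²)`, `θ(0) = 0`, `θ(1) = π/2` —
and the two integral identities `∫₀^π h = ∫₀¹ (h∘θ + h∘(π−θ))·2/√(2−w²)` (Mathlib's monotone change of variables
`integral_comp_mul_deriv_of_deriv_nonneg/nonpos`, continuous `h`) and `∫₀^{2π} h = ∫₀^π h + ∫₀^π h(2π−·)`; §2 the edge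
loop of the ITER-like instance in the new variable: `u(θ(w)) = U₊(w)`, `u(π−θ(w)) = U₋(w)`, `|∇Ψ|²·u = 4αρ²·P(cos t)` so
`|∇Ψ|²(θ) = 4αρ²P₊/U₊`, `|∇Ψ|²(π−θ) = 4αρ²P₋/U₋`, and the densities `w = κ₀/(2c√u)`, `∂w/∂r = −κ₀R_a cos t/(2c·u√u)` with
the Lee–Cerfon amplitude `c = κ₀F/(2R_a³q₀) = 1/2 + 4d₃ = 2257675225/6032287802` (`IterLike.lcAmplitude`).
HONEST FRAMING (LADDER-GRIDFUSION three columns, never merged): CERTIFIED = kernel identities/inequalities about the MODEL's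
edge surface (ideal MHD, axisymmetric, Solov'ev profiles `μ₀p′ = −1`, `FF′ = 0`, analytic fixed-boundary PCF equilibrium
[cite: PatakiCerfonFreidberg2013, §6.1], free constant `F = RB_φ` a parameter); VALIDATED cross-checks live in
`pub/gridfusion/cert/F/mercier-dm-validated.md`; Mercier/GGJ is a NECESSARY (local interchange) criterion; nothing here says
any plasma or device is stable. No `native_decide`; no `decide` in this file (the enclosures are the imported Data files').
-/

noncomputable section

open Real MeasureTheory Set intervalIntegral
open Literature.Analysis.ValidatedNumerics Literature.Analysis.ValidatedNumerics.PolyMP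
open Literature.Analysis.ValidatedNumerics.ExpPoly (Poly)
open Literature.MathematicalPhysics.MHD Literature.MathematicalPhysics.MHD.Solovev
open Summit.Ventures.FusionMHD.Models.SolovevPCF

namespace Summit.Ventures.FusionMHD.Bench.SolovevPCFIter.MercierEdge

/-! ## §1 The half-angle substitution `t = θ(w) = 2·arcsin(√2·w/2)` (`cos θ = 1 − w²`) -/

/-- `θ(w) = 2·arcsin(√2·w/2)`: the substitution with `cos θ(w) = 1 − w²`, taking `w ∈ [0,1]` monotonically onto
`t ∈ [0, π/2]`; it is the composite of `s = cos t` and `s = 1 − w²` of the Data files' §0, written as ONE smooth map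
(no endpoint singularity: `θ′(w) = 2/√(2 − w²)`). [folklore] -/
def theta (w : ℝ) : ℝ := 2 * Real.arcsin (Real.sqrt 2 / 2 * w)

/-- `(√2·w/2)² = w²/2`. [folklore] -/
theorem theta_arg_sq (w : ℝ) : (Real.sqrt 2 / 2 * w) ^ 2 = w ^ 2 / 2 := by
  rw [mul_pow, div_pow, Real.sq_sqrt (by norm_num : (0:ℝ) ≤ 2)]; ring

/-- `√2·w/2 < 1` for `w ≤ 1`. [folklore] -/
theorem theta_arg_lt_one {w : ℝ} (hw : w ≤ 1) : Real.sqrt 2 / 2 * w < 1 := by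
  have h2 : Real.sqrt 2 < 2 := by
    rw [show (2 : ℝ) = Real.sqrt 4 by
      rw [show (4 : ℝ) = 2 ^ 2 by norm_num, Real.sqrt_sq (by norm_num)]]
    exact Real.sqrt_lt_sqrt (by norm_num) (by norm_num)
  have hs : 0 < Real.sqrt 2 := Real.sqrt_pos.2 (by norm_num)
  nlinarith

/-- `cos θ(w) = 1 − w²` on `[0,1]`. [folklore] -/
theorem cos_theta {w : ℝ} (hw : w ∈ Icc (0 : ℝ) 1) : Real.cos (theta w) = 1 - w ^ 2 := by
  unfold theta
  rw [Real.cos_two_mul, Real.cos_arcsin, Real.sq_sqrt, theta_arg_sq]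
  · ring
  · rw [theta_arg_sq]; nlinarith [hw.1, hw.2]

/-- `sin² θ(w) = w²(2 − w²)` on `[0,1]`. [folklore] -/
theorem sin_sq_theta {w : ℝ} (hw : w ∈ Icc (0 : ℝ) 1) : Real.sin (theta w) ^ 2 = w ^ 2 * (2 - w ^ 2) := by
  rw [Real.sin_sq, cos_theta hw]; ring

/-- `θ(0) = 0`. [folklore] -/
theorem theta_zero : theta 0 = 0 := by simp [theta]

/-- `θ(1) = π/2` (`arcsin(√2/2) = π/4`). [folklore] -/
theorem theta_one : theta 1 = π / 2 := by
  unfold theta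
  rw [mul_one, Real.arcsin_eq_of_sin_eq (Real.sin_pi_div_four)
    ⟨by linarith [Real.pi_pos], by linarith [Real.pi_pos]⟩]
  ring

/-- `θ` is continuous. [folklore] -/
theorem continuous_theta : Continuous theta := by
  unfold theta; fun_prop

/-- `θ′(w) = 2/√(2 − w²)` on `[0,1]`. [folklore] -/
theorem hasDerivAt_theta {w : ℝ} (hw : w ∈ Icc (0 : ℝ) 1) :
    HasDerivAt theta (2 / Real.sqrt (2 - w ^ 2)) w := by
  have hlt := theta_arg_lt_one hw.2
  have hne1 : Real.sqrt 2 / 2 * w ≠ -1 := by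
    have : 0 ≤ Real.sqrt 2 / 2 * w := mul_nonneg (by positivity) hw.1
    linarith
  have hd := ((Real.hasDerivAt_arcsin hne1 hlt.ne).comp w
    ((hasDerivAt_id w).const_mul (Real.sqrt 2 / 2))).const_mul 2
  unfold theta
  refine hd.congr_deriv ?_
  rw [mul_one, theta_arg_sq]
  have hpos : 0 < 2 - w ^ 2 := by nlinarith [hw.1, hw.2]
  have e : Real.sqrt (1 - w ^ 2 / 2) = Real.sqrt (2 - w ^ 2) / Real.sqrt 2 := by
    rw [← Real.sqrt_div (by linarith)]; congr 1; field_simp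
  rw [e]
  have hs2 : Real.sqrt 2 ≠ 0 := (Real.sqrt_pos.2 (by norm_num)).ne'
  have hs : Real.sqrt (2 - w ^ 2) ≠ 0 := (Real.sqrt_pos.2 hpos).ne'
  field_simp
  rw [Real.sq_sqrt (by norm_num : (0:ℝ) ≤ 2)]

/-- **Half-angle substitution on `[0, π]`** (Mathlib's monotone change of variables, both quarter periods): for a
continuous `h`, `∫₀^π h(t) dt = ∫₀¹ (h(θ(w)) + h(π − θ(w)))·(2/√(2−w²)) dw` with `cos θ(w) = 1 − w²`,
`cos(π − θ(w)) = −(1 − w²)`. This is the `Σ_σ ∫₀¹ 2 f(s_σ(w), U_σ(w)) dw/√(2−w²)` form of the Data files' §0,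
now a theorem about the `t`-integral itself. [folklore] -/
theorem integral_zero_pi_eq_theta (h : ℝ → ℝ) (hh : Continuous h) :
    ∫ t in (0 : ℝ)..π, h t
      = ∫ w in (0 : ℝ)..1, (h (theta w) + h (π - theta w)) * (2 / Real.sqrt (2 - w ^ 2)) := by
  have hIoo : ∀ x ∈ Ioo (min (0:ℝ) 1) (max (0:ℝ) 1), x ∈ Icc (0:ℝ) 1 := fun x hx => by
    rw [min_eq_left zero_le_one, max_eq_right zero_le_one] at hx
    exact ⟨hx.1.le, hx.2.le⟩
  have hA := integral_comp_mul_deriv_of_deriv_nonneg (f := theta)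
    (f' := fun w => 2 / Real.sqrt (2 - w ^ 2)) (g := h) (a := 0) (b := 1)
    continuous_theta.continuousOn (fun x hx => hasDerivAt_theta (hIoo x hx))
    (fun x _ => by positivity)
  have hB := integral_comp_mul_deriv_of_deriv_nonpos (f := fun w => π - theta w)
    (f' := fun w => -(2 / Real.sqrt (2 - w ^ 2))) (g := h) (a := 0) (b := 1)
    (continuous_const.sub continuous_theta).continuousOn
    (fun x hx => (hasDerivAt_theta (hIoo x hx)).const_sub π)
    (fun x _ => by
      have : 0 ≤ 2 / Real.sqrt (2 - x ^ 2) := by positivity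
      linarith)
  rw [theta_zero, theta_one] at hA
  simp only [theta_zero, theta_one, sub_zero, Function.comp] at hB
  rw [show π - π / 2 = π / 2 by ring] at hB
  have hB' : ∫ x in (0:ℝ)..1, h (π - theta x) * (2 / Real.sqrt (2 - x ^ 2))
      = ∫ t in (π / 2)..π, h t := by
    rw [integral_symm π (π / 2), ← hB, ← intervalIntegral.integral_neg]
    congr 1; funext x; ring
  have hsplit : ∫ t in (0 : ℝ)..π, h t = (∫ t in (0:ℝ)..(π/2), h t) + ∫ t in (π/2)..π, h t :=
    (integral_add_adjacent_intervals (hh.intervalIntegrable _ _) (hh.intervalIntegrable _ _)).symm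
  rw [hsplit, ← hA, ← hB']
  have hiA : IntervalIntegrable (fun x => (h ∘ theta) x * (2 / Real.sqrt (2 - x ^ 2))) volume 0 1 := by
    rw [integrable_comp_mul_deriv_iff_of_deriv_nonneg continuous_theta.continuousOn
      (fun x hx => hasDerivAt_theta (hIoo x hx)) (fun x _ => by positivity)]
    exact hh.intervalIntegrable _ _
  have hiB : IntervalIntegrable (fun x => h (π - theta x) * (2 / Real.sqrt (2 - x ^ 2))) volume 0 1 := by
    have := ((integrable_comp_mul_deriv_iff_of_deriv_nonpos
      (f := fun w => π - theta w) (f' := fun w => -(2 / Real.sqrt (2 - w ^ 2))) (g := h) (a := 0) (b := 1)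
      (continuous_const.sub continuous_theta).continuousOn
      (fun x hx => (hasDerivAt_theta (hIoo x hx)).const_sub π)
      (fun x _ => by
        have : 0 ≤ 2 / Real.sqrt (2 - x ^ 2) := by positivity
        linarith)).2 (hh.intervalIntegrable _ _)).neg
    refine this.congr ?_
    intro x _; simp only [Function.comp, Pi.neg_apply]; ring
  rw [← integral_add hiA hiB]
  congr 1; funext x; simp only [Function.comp]; ring

/-- Splitting `[0, 2π]` by the reflection `t ↦ 2π − t`: `∫₀^{2π} h = ∫₀^π h(t) dt + ∫₀^π h(2π − t) dt`
(continuous `h`). [folklore] -/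
theorem integral_zero_two_pi_eq (h : ℝ → ℝ) (hh : Continuous h) :
    ∫ t in (0 : ℝ)..(2 * π), h t = (∫ t in (0 : ℝ)..π, h t) + ∫ t in (0 : ℝ)..π, h (2 * π - t) := by
  rw [intervalIntegral.integral_comp_sub_left (fun t => h t) (2 * π), show 2 * π - π = π by ring, sub_zero]
  exact (integral_add_adjacent_intervals (hh.intervalIntegrable _ _) (hh.intervalIntegrable _ _)).symm

/-- Both steps at once for an integrand that is even about `π`, i.e. a function of `cos t` (and `sin² t`):
`∫₀^{2π} h = 2∫₀¹ (h(θ(w)) + h(π − θ(w)))·(2/√(2−w²)) dw`. [folklore] -/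
theorem integral_zero_two_pi_eq_theta (h : ℝ → ℝ) (hh : Continuous h) (hsym : ∀ t, h (2 * π - t) = h t) :
    ∫ t in (0 : ℝ)..(2 * π), h t
      = 2 * ∫ w in (0 : ℝ)..1, (h (theta w) + h (π - theta w)) * (2 / Real.sqrt (2 - w ^ 2)) := by
  rw [integral_zero_two_pi_eq h hh, ← integral_zero_pi_eq_theta h hh]
  simp only [hsym]
  ring

/-! ## §2 The printed edge loop of the ITER-like instance in the substituted variable

Lee–Cerfon label of the plasma edge `Ψ = 0`: `r = a = ε/R_a` (`Models/SolovevPCFSafetyFactorProfile`), so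
`rR_a = ε = 8/25`, `u(t) = R² = R_a² + 2εcos t = 689/625 + (16/25)cos t`; hence `u(θ(w)) = U₊(w)`,
`u(π − θ(w)) = U₋(w)` (the Qedge file's `Uplus/Uminus`), and `|∇Ψ|²·u = 4αρ²·P(cos t)` with `P₊/P₋` of Data1. -/

/-- The Lee–Cerfon amplitude `c = κ₀F/(2R_a³q₀(F)) = 1/2 + 4d₃` as the literal rational. [folklore] -/
theorem lcAmp_eq {g : ℝ} (hg : g ≠ 0) :
    IterLike.kappa0 * g / (2 * IterLike.Ra ^ 3 * IterLike.q0 g) = (2257675225 / 6032287802 : ℝ) := by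
  rw [IterLike.lcAmplitude hg]; unfold IterLike.d₃; norm_num

/-- `(ε/R_a)·R_a = ε = 8/25`. [folklore] -/
theorem edge_r_mul_Ra : IterLike.ε / IterLike.Ra * IterLike.Ra = 8 / 25 := by
  rw [div_mul_cancel₀ _ IterLike.Ra_pos.ne']; unfold IterLike.ε; norm_num

/-- `u(t) = 689/625 + (16/25)cos t` on the edge loop. [folklore] -/
theorem lcU_edge (t : ℝ) :
    lcU IterLike.Ra (IterLike.ε / IterLike.Ra) t = 689 / 625 + 16 / 25 * Real.cos t := by
  unfold lcU
  rw [IterLike.Ra_sq, show 2 * (IterLike.ε / IterLike.Ra) * IterLike.Ra * Real.cos t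
    = 2 * (IterLike.ε / IterLike.Ra * IterLike.Ra) * Real.cos t by ring, edge_r_mul_Ra]
  ring

/-- `u` is even about `π`. [folklore] -/
theorem lcU_two_pi_sub (t : ℝ) :
    lcU IterLike.Ra (IterLike.ε / IterLike.Ra) (2 * π - t) = lcU IterLike.Ra (IterLike.ε / IterLike.Ra) t := by
  rw [lcU_edge, lcU_edge, Real.cos_two_pi_sub]

/-- `u(θ(w)) = U₊(w)`. [folklore] -/
theorem lcU_theta {w : ℝ} (hw : w ∈ Icc (0 : ℝ) 1) :
    lcU IterLike.Ra (IterLike.ε / IterLike.Ra) (theta w) = Uplus w := by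
  rw [lcU_edge, cos_theta hw]; unfold Uplus; push_cast; ring

/-- `u(π − θ(w)) = U₋(w)`. [folklore] -/
theorem lcU_pi_sub_theta {w : ℝ} (hw : w ∈ Icc (0 : ℝ) 1) :
    lcU IterLike.Ra (IterLike.ε / IterLike.Ra) (π - theta w) = Uminus w := by
  rw [lcU_edge, Real.cos_pi_sub, cos_theta hw]; unfold Uminus; push_cast; ring

/-- `u > 0` on the edge loop. [folklore] -/
theorem lcU_edge_pos (t : ℝ) : 0 < lcU IterLike.Ra (IterLike.ε / IterLike.Ra) t :=
  lcU_pos IterLike.Ra_pos IterLike.edge_minorRadius.1.le IterLike.edge_minorRadius.2 t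

/-- **`|∇Ψ|²·u = 4αρ²·P(cos t)` on the edge loop**, `P(s) = α(2su + ρ(1−s²))² + 4|d₃|u²(1−s²)` — the structure
behind Data1's `P₊/P₋` (`κ₀² = E = α/|d₃|`, `(2caR_a)² = c²ρ²`, `c = 4α`). [folklore] -/
theorem lcGradSq_edge {g : ℝ} (hg : g ≠ 0) (t : ℝ) :
    lcGradSq IterLike.kappa0 g IterLike.Ra (IterLike.q0 g) (IterLike.ε / IterLike.Ra) t
        * lcU IterLike.Ra (IterLike.ε / IterLike.Ra) t
      = c4 * ((2257675225/24129151208 : ℝ)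
          * (2 * Real.cos t * lcU IterLike.Ra (IterLike.ε / IterLike.Ra) t + (16/25 : ℝ) * (1 - Real.cos t ^ 2)) ^ 2
          + (379234338/3016143901 : ℝ) * lcU IterLike.Ra (IterLike.ε / IterLike.Ra) t ^ 2 * (1 - Real.cos t ^ 2)) := by
  have hu := lcU_edge_pos t
  unfold lcGradSq
  rw [show (2 * (IterLike.kappa0 * g / (2 * IterLike.Ra ^ 3 * IterLike.q0 g)) * (IterLike.ε / IterLike.Ra)
      * IterLike.Ra) = 2 * (IterLike.kappa0 * g / (2 * IterLike.Ra ^ 3 * IterLike.q0 g))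
      * (IterLike.ε / IterLike.Ra * IterLike.Ra) by ring, lcAmp_eq hg,
    show IterLike.ε / IterLike.Ra * IterLike.Ra * Real.sin t ^ 2
      = (IterLike.ε / IterLike.Ra * IterLike.Ra) * Real.sin t ^ 2 by ring, edge_r_mul_Ra,
    IterLike.kappa0_sq, Real.sin_sq]
  unfold IterLike.elongSq c4
  field_simp
  ring

/-- `|∇Ψ|²(θ(w)) = 4αρ²·P₊(w)/U₊(w)`. [folklore] -/
theorem lcGradSq_theta {g : ℝ} (hg : g ≠ 0) {w : ℝ} (hw : w ∈ Icc (0 : ℝ) 1) :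
    lcGradSq IterLike.kappa0 g IterLike.Ra (IterLike.q0 g) (IterLike.ε / IterLike.Ra) (theta w)
      = c4 * Pplus w / Uplus w := by
  have hu : 0 < Uplus w := Uplus_pos hw
  rw [eq_div_iff hu.ne', ← lcU_theta hw, lcGradSq_edge hg, lcU_theta hw, cos_theta hw, Pplus_eq]
  unfold splus
  ring

/-- `|∇Ψ|²(π − θ(w)) = 4αρ²·P₋(w)/U₋(w)`. [folklore] -/
theorem lcGradSq_pi_sub_theta {g : ℝ} (hg : g ≠ 0) {w : ℝ} (hw : w ∈ Icc (0 : ℝ) 1) :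
    lcGradSq IterLike.kappa0 g IterLike.Ra (IterLike.q0 g) (IterLike.ε / IterLike.Ra) (π - theta w)
      = c4 * Pminus w / Uminus w := by
  have hu : 0 < Uminus w := Uminus_pos w
  rw [eq_div_iff hu.ne', ← lcU_pi_sub_theta hw, lcGradSq_edge hg, lcU_pi_sub_theta hw, Real.cos_pi_sub,
    cos_theta hw, Pminus_eq]
  unfold sminus
  ring

/-- `|∇Ψ|²` is even about `π` on the edge loop. [folklore] -/
theorem lcGradSq_two_pi_sub {g : ℝ} (hg : g ≠ 0) (t : ℝ) :
    lcGradSq IterLike.kappa0 g IterLike.Ra (IterLike.q0 g) (IterLike.ε / IterLike.Ra) (2 * π - t)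
      = lcGradSq IterLike.kappa0 g IterLike.Ra (IterLike.q0 g) (IterLike.ε / IterLike.Ra) t := by
  have hu := lcU_edge_pos t
  have h1 := lcGradSq_edge hg (2 * π - t)
  have h2 := lcGradSq_edge hg t
  rw [lcU_two_pi_sub, Real.cos_two_pi_sub] at h1
  exact mul_right_cancel₀ hu.ne' (h1.trans h2.symm)

/-- The density `w(t) = κ₀/(2c√u)` on the edge loop. [folklore] -/
theorem lcAvgWeight_edge {g : ℝ} (hg : g ≠ 0) (t : ℝ) :
    lcAvgWeight IterLike.kappa0 g IterLike.Ra (IterLike.q0 g) (IterLike.ε / IterLike.Ra) t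
      = IterLike.kappa0 / (2 * (2257675225 / 6032287802 : ℝ))
          * (Real.sqrt (lcU IterLike.Ra (IterLike.ε / IterLike.Ra) t))⁻¹ := by
  unfold lcAvgWeight
  rw [lcAmp_eq hg, div_eq_mul_inv, div_eq_mul_inv, mul_inv]
  ring

/-- `∂w/∂r(t) = −κ₀R_a cos t/(2c·u√u)` on the edge loop. [folklore] -/
theorem lcAvgWeightDr_edge {g : ℝ} (hg : g ≠ 0) (t : ℝ) :
    lcAvgWeightDr IterLike.kappa0 g IterLike.Ra (IterLike.q0 g) (IterLike.ε / IterLike.Ra) t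
      = -(IterLike.kappa0 * IterLike.Ra / (2 * (2257675225 / 6032287802 : ℝ)))
          * (Real.cos t * (lcU IterLike.Ra (IterLike.ε / IterLike.Ra) t
              * Real.sqrt (lcU IterLike.Ra (IterLike.ε / IterLike.Ra) t))⁻¹) := by
  unfold lcAvgWeightDr
  rw [lcAmp_eq hg]
  ring


end Summit.Ventures.FusionMHD.Bench.SolovevPCFIter.MercierEdge

end
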